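import Mathlib
import HarnessLib
import Summits.AtomisticToContinuum.FouriersLaw.Theses.TangentFlowDephasing

/-!
# `TangentFlowDephasing.Assembly` — proved

Item `stmt-AtomisticToContinuum-12159` (assembly, route `TangentFlowDephasing`, sub-problem
`FouriersLaw`):
`OnePhononL2Decay → LifetimeControlsCurrent → NoSelfLocalization → NessUnique →
FiniteResponseOfUnique → ThermodynamicLimit → FouriersLaw`.

This is literally the (curried) type of the route's deciding theorem `closes`
(`Summits/AtomisticToContinuum/FouriersLaw/Theses/TangentFlowDephasing.lean`): clause (i) of
`FouriersLawFor` from the proved existence theorem `pinnedChain_exists_isSteadyState` plus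
`NessUnique`; clause (ii) from the Green–Kubo pair produced by
`OnePhononL2Decay → LifetimeControlsCurrent → NoSelfLocalization` at every `T > 0`, the witness of
`ThermodynamicLimit` (conductivity `κ T := greenKuboConductivity`, positive by `HasGreenKubo.pos`)
and the finite-`N` response limits of `FiniteResponseOfUnique`.  The file records the item-closing
theorem whose type is the route decl `Assembly` by name.
-/

namespace Summit.AtomisticToContinuum.FouriersLaw.Theorems

/-- Settles `stmt-AtomisticToContinuum-12159` (assembly of route `TangentFlowDephasing`): the three
own cruxes `OnePhononL2Decay` (SD1), `LifetimeControlsCurrent` (SD2), `NoSelfLocalization` (SD3),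
weak steady-state uniqueness `NessUnique`, existence of the finite-`N` response limits
`FiniteResponseOfUnique` and the shared thermodynamic-limit crux `ThermodynamicLimit` imply the
sub-problem statement `FouriersLaw`.  Proof: the route's deciding theorem `closes` (after unfolding
`Assembly`). [folklore] -/
theorem tangentFlowDephasing_assembly_proof :
    Summit.AtomisticToContinuum.FouriersLaw.Theses.TangentFlowDephasing.Assembly := by
  unfold Summit.AtomisticToContinuum.FouriersLaw.Theses.TangentFlowDephasing.Assembly
  exact Summit.AtomisticToContinuum.FouriersLaw.Theses.TangentFlowDephasing.closes

end Summit.AtomisticToContinuum.FouriersLaw.Theorems
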